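import Literature.Probability.RandomPlanarGeometry.HexSAWStripBetaCoefficientAllWidths
import Literature.Probability.RandomPlanarGeometry.HexSAWStripSurfaceWidthTwoLimit
import HarnessLib

/-!
# The width-two strip in closed form at its threshold: `β_{2,m} · y_2^m → (45 + √2)/28` and `(y_2 − y) · B_2(x_c; y) → (233 + 185√2)/98`
# (module «BETA-COEFF-WIDTH-TWO»)

Topic `Literature/Probability/RandomPlanarGeometry` (continues «BETA-COEFF-ALL-T» `HexSAWStripBetaCoefficientAllWidths.lean` — for every
`T ≥ 1` there is `Λ_T > 0` with `β_{T,m} y_T^m → Λ_T` and `(y_T − y) B_T(x_c; y) → Λ_T y_T` — and the SOLVED width-two strip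
`HexSAWStripSurfaceWidthTwoLimit.lean`: `HV.stripByLim_two_eq : B_2(x_c; y) = W2.limB2 y` for `0 ≤ y < y_2`, a rational function of
`(x_c, y)` built from the `2 × 2` resolvent `W2.Rbot/Rtop` with denominator `W2.wdet x_c y`, and `HV.W2.yTwo_eq : y_2 = (10 + 8√2)/7`,
`HV.stripYT_two`).  Lane «pcv-sawmu» (CriticalPhenomena venture), a-p2 g21.  Sources of the SETTING: N. R. Beaton, M. Bousquet-Mélou,
J. de Gier, H. Duminil-Copin, A. J. Guttmann, CMP 326 (2014) §3.2 and Corollary 8 (arXiv:1109.0358v5 p. 12: `y_T`); N. R. Beaton,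
A. J. Guttmann, I. Jensen, J. Phys. A 45 (2012) §2 (the narrowest strip series at `y = 1`); H. Duminil-Copin, S. Smirnov, Ann. Math. 175
(2012) Theorem 1 (`x_c = 1/√(2+√2)`).  The two numbers below are the lane's (nothing of the kind is printed): the FIRST β-coefficient
amplitude in closed form beyond the trivial width one (`Λ_1 = 2`).

## What is proved (namespace `Literature.Probability.RandomPlanarGeometry.SAW.HV`)

* §1 `xc_sq_eq_half` (`x_c² = (2 − √2)/2`), `kTwo` (`κ_2 = x_c²(1 − x_c² + x_c⁴)`), `kTwo_pos_mul_yTwo` (`κ_2 y_2 = 1 − x_c²`),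
  ★ `wdet_xc_eq` — `det(I − M_{x_c}(y)) = κ_2 (y_2 − y)` (linear in `y`); `regB2` (the regular part) and ★ `sub_mul_limB2_eq` —
  `(y_2 − y) · limB2 y = regB2 y (E(y))` for `y < y_2` (pole cancellation); `widthTwo_values` (`x_c² y_2 = (2+3√2)/7`,
  `x_c⁴ y_2 = (2√2−1)/7`, `E(y_2) = x_c(1+√2)/2`, `κ_2 = (8−5√2)/4`); ★ `regB2_yTwo_eq` — the value at the pole `(233 + 185√2)/98`.
* §2 ★★★ `tendsto_sub_mul_limB2`, `stripYT_two_eq_yTwo`, ★★★★ `tendsto_sub_mul_stripByLim_two` —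
  `(y_2 − y) · B_2(x_c; y) ⟶ (233 + 185√2)/98 = 5.04723…` as `y ↑ y_2`; ★★★★ `tendsto_stripBcoeff_two_mul_pow` —
  `β_{2,m} · y_2^m ⟶ Λ_2 = (45 + √2)/28 = 1.65765048…`: the `x_c`-weighted number of walks of the two-cell strip from the mid-edge `a`
  to the upper boundary with `m` surface contacts is `(Λ_2 + o(1)) · ((10 + 8√2)/7)^{−m}` — a number the enumeration side can test
  (`β_{2,m}` by transfer matrix: `β_{2,m} y_2^m = 1.4776, 1.5906, 1.6349, …, 1.65764557 (m = 10), 1.6576504843568 (m = 20)` from the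
  closed form's own power series).

Label: LANE THEOREM (own result of lane «pcv-sawmu», a-p2 g21, 2026-08-26).  NOT claimed: widths `T ≥ 3` in closed form, uniformity.
-/

noncomputable section

open Finset Filter Topology Literature.Probability.LatticeModels Literature.Probability.Percolation

namespace Literature.Probability.RandomPlanarGeometry.SAW.HV

open W2

/-! ### §1 Algebra at `x = x_c`: the determinant factorises through `y_2`, and the values at `y_2` -/

/-- `x_c² = (2 − √2)/2`. [cite: DuminilCopinSmirnov2012, Theorem 1 (x_c = 1/√(2+√2)); lane plumbing] -/
theorem xc_sq_eq_half : hexCriticalFugacity ^ 2 = (2 - Real.sqrt 2) / 2 := by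
  have h := W2.sqrt_two_eq
  linarith

/-- `κ_2 := x_c²(1 − x_c² + x_c⁴)`, the slope of the determinant in `y` (plumbing). [cite: BeatonGuttmannJensen2012, §2 (the width-one (lane: width-two) transfer matrix); lane plumbing] -/
def kTwo : ℝ := hexCriticalFugacity ^ 2 * (1 - hexCriticalFugacity ^ 2 + hexCriticalFugacity ^ 4)

/-- `κ_2 > 0` and `κ_2 · y_2 = 1 − x_c²`. [cite: BeatonBousquetMelouDeGierDuminilCopinGuttmann2014, Corollary 8 (arXiv v5 p. 12: y_T); lane plumbing] -/
theorem kTwo_pos_mul_yTwo : 0 < kTwo ∧ kTwo * yTwo = 1 - hexCriticalFugacity ^ 2 := by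
  refine ⟨yTwo_den_pos, ?_⟩
  have hx := hexCriticalFugacity_pos_lt_one
  have hx0 : hexCriticalFugacity ≠ 0 := hx.1.ne'
  have hp : 1 - hexCriticalFugacity ^ 2 + hexCriticalFugacity ^ 4 ≠ 0 := by nlinarith [sq_nonneg (hexCriticalFugacity ^ 2), hx.1, hx.2]
  unfold kTwo yTwo
  field_simp

/-- `det(I − M_{x_c}(y)) = κ_2 · (y_2 − y)`: the determinant is LINEAR in `y` and vanishes at `y_2`.
[cite: BeatonGuttmannJensen2012, §2 (the width-one (lane: width-two) transfer matrix); lane plumbing] -/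
theorem wdet_xc_eq (y : ℝ) : wdet hexCriticalFugacity y = kTwo * (yTwo - y) := by
  have h1 := kTwo_pos_mul_yTwo.2
  have h2 : kTwo = hexCriticalFugacity ^ 2 * (1 - hexCriticalFugacity ^ 2 + hexCriticalFugacity ^ 4) := rfl
  rw [mul_sub, h1, h2]
  unfold wdet
  ring

/-- The regular part: `(y_2 − y) · B_2(x_c; y)` with the pole cancelled — a polynomial in `y` and `E(y) = x_c³y/(1 − x_c⁴y)` (plumbing).
[cite: BeatonGuttmannJensen2012, §2; lane plumbing] -/
def regB2 (y e : ℝ) : ℝ :=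
  2 * (hexCriticalFugacity * (e * ((1 - hexCriticalFugacity ^ 2 * y) / kTwo - (yTwo - y)) + hexCriticalFugacity ^ 3 * y / kTwo +
    e * (e * (hexCriticalFugacity ^ 3 / kTwo) + (1 - hexCriticalFugacity ^ 2) / kTwo - (yTwo - y)))) +
  2 * (hexCriticalFugacity * e) * (yTwo - y)

/-- ★ **Pole cancellation**: for `y < y_2`, `(y_2 − y) · limB2 y = regB2 y (E(y))`. [cite: BeatonBousquetMelouDeGierDuminilCopinGuttmann2014, Corollary 8 (arXiv v5 p. 12: the radius y_T); BeatonGuttmannJensen2012, §2; lane «pcv-sawmu» a-p2 g21] -/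
theorem sub_mul_limB2_eq {y : ℝ} (hy : y < yTwo) : (yTwo - y) * limB2 y = regB2 y (Einf y) := by
  have hκ0 : kTwo ≠ 0 := kTwo_pos_mul_yTwo.1.ne'
  have hyy : yTwo - y ≠ 0 := (sub_pos.2 hy).ne'
  have hfac : wdet hexCriticalFugacity y = kTwo * (yTwo - y) := wdet_xc_eq y
  unfold limB2 Rbot Rtop regB2
  simp only [oneBot, oneTop, Bool.false_eq_true, if_true, if_false, mul_one, mul_zero, add_zero, zero_add]
  rw [hfac]
  field_simp
  ring

/-- The threshold values: `x_c² y_2 = (2 + 3√2)/7`, `x_c⁴ y_2 = (2√2 − 1)/7`, `E(y_2) = x_c (1 + √2)/2`,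
`x_c²(1 − x_c² + x_c⁴) = (8 − 5√2)/4` (plumbing, from `x_c² = (2 − √2)/2`, `y_2 = (10 + 8√2)/7`).
[cite: DuminilCopinSmirnov2012, Theorem 1; lane plumbing] -/
theorem widthTwo_values :
    hexCriticalFugacity ^ 2 * yTwo = (2 + 3 * Real.sqrt 2) / 7 ∧ hexCriticalFugacity ^ 4 * yTwo = (2 * Real.sqrt 2 - 1) / 7 ∧
      Einf yTwo = hexCriticalFugacity * ((1 + Real.sqrt 2) / 2) ∧ kTwo = (8 - 5 * Real.sqrt 2) / 4 := by
  have hr : Real.sqrt 2 ^ 2 = 2 := Real.sq_sqrt (by norm_num)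
  have hq := xc_sq_eq_half
  have hy := yTwo_eq
  have hx := hexCriticalFugacity_pos_lt_one
  have hq2 : hexCriticalFugacity ^ 4 = ((2 - Real.sqrt 2) / 2) ^ 2 := by rw [← hq]; ring
  have hA : hexCriticalFugacity ^ 2 * yTwo = (2 + 3 * Real.sqrt 2) / 7 := by
    rw [hq, hy]; linear_combination (-4 / 7 : ℝ) * hr
  have hB : hexCriticalFugacity ^ 4 * yTwo = (2 * Real.sqrt 2 - 1) / 7 := by
    rw [hq2, hy]; linear_combination (-11 / 14 + 2 / 7 * Real.sqrt 2) * hr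
  have hκ : kTwo = (8 - 5 * Real.sqrt 2) / 4 := by
    unfold kTwo; rw [hq2, hq]; linear_combination (1 / 2 - 1 / 8 * Real.sqrt 2) * hr
  refine ⟨hA, hB, ?_, hκ⟩
  have hden : 1 - hexCriticalFugacity ^ 4 * yTwo ≠ 0 := by rw [hB]; nlinarith [Real.sqrt_nonneg 2, hr]
  rw [Einf, div_eq_iff hden]
  have : hexCriticalFugacity ^ 3 * yTwo - hexCriticalFugacity * ((1 + Real.sqrt 2) / 2) * (1 - hexCriticalFugacity ^ 4 * yTwo) =
      hexCriticalFugacity * (hexCriticalFugacity ^ 2 * yTwo - (1 + Real.sqrt 2) / 2 * (1 - hexCriticalFugacity ^ 4 * yTwo)) := by ring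
  rw [← sub_eq_zero, this, hA, hB]
  have h0 : (2 + 3 * Real.sqrt 2) / 7 - (1 + Real.sqrt 2) / 2 * (1 - (2 * Real.sqrt 2 - 1) / 7) = 0 := by
    linear_combination (1 / 7 : ℝ) * hr
  rw [h0, mul_zero]

/-- ★ **The value at the pole**: `regB2 y_2 (E(y_2)) = (233 + 185√2)/98`. [cite: DuminilCopinSmirnov2012, Theorem 1; BeatonGuttmannJensen2012, §2; lane «pcv-sawmu» a-p2 g21] -/
theorem regB2_yTwo_eq : regB2 yTwo (Einf yTwo) = (233 + 185 * Real.sqrt 2) / 98 := by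
  have hr : Real.sqrt 2 ^ 2 = 2 := Real.sq_sqrt (by norm_num)
  have hq := xc_sq_eq_half
  obtain ⟨hA, hB, hE, hκ⟩ := widthTwo_values
  have hκpos := kTwo_pos_mul_yTwo.1
  have hκ0 : (8 - 5 * Real.sqrt 2) / 4 ≠ 0 := by rw [← hκ]; exact hκpos.ne'
  -- the pole terms `(y_2 − y)` vanish at `y = y_2`; regroup in even powers of `x_c`
  have hre : regB2 yTwo (Einf yTwo) =
      2 * hexCriticalFugacity ^ 2 / kTwo *
        ((1 + Real.sqrt 2) / 2 * (1 - hexCriticalFugacity ^ 2 * yTwo) + hexCriticalFugacity ^ 2 * yTwo +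
          ((1 + Real.sqrt 2) / 2) ^ 2 * hexCriticalFugacity ^ 4 + (1 + Real.sqrt 2) / 2 * (1 - hexCriticalFugacity ^ 2)) := by
    have hκ0' : kTwo ≠ 0 := hκpos.ne'
    rw [regB2, hE]
    simp only [sub_self, mul_zero, sub_zero, add_zero]
    field_simp
    ring
  have hq2 : hexCriticalFugacity ^ 4 = (3 - 2 * Real.sqrt 2) / 2 := by
    rw [show hexCriticalFugacity ^ 4 = (hexCriticalFugacity ^ 2) ^ 2 by ring, hq]; linear_combination (1 / 4 : ℝ) * hr
  rw [hre, hκ, hA, hq, hq2, div_mul_eq_mul_div, div_eq_iff hκ0]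
  linear_combination ((533 / 392 : ℝ) + (-23 / 56 : ℝ) * Real.sqrt 2 + (1 / 4 : ℝ) * Real.sqrt 2 ^ 2) * hr

/-! ### §2 ★★★★ The residue and the coefficient amplitude of the width-two strip, in closed form -/

/-- ★★★ `(y_2 − y) · W2.limB2 y → (233 + 185√2)/98` as `y ↑ y_2` (continuity of the regular part). [cite: BeatonBousquetMelouDeGierDuminilCopinGuttmann2014, Corollary 8 (arXiv v5 p. 12); BeatonGuttmannJensen2012, §2; lane «pcv-sawmu» a-p2 g21 — own] -/
theorem tendsto_sub_mul_limB2 :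
    Tendsto (fun y => (yTwo - y) * limB2 y) (𝓝[<] yTwo) (𝓝 ((233 + 185 * Real.sqrt 2) / 98)) := by
  have h4 : 1 - hexCriticalFugacity ^ 4 * yTwo ≠ 0 := (sub_pos.2 (xc_four_mul_lt_one le_rfl)).ne'
  have hE : ContinuousAt Einf yTwo := by
    have : Einf = fun y => hexCriticalFugacity ^ 3 * y / (1 - hexCriticalFugacity ^ 4 * y) := by funext y; rfl
    rw [this]
    exact ContinuousAt.div (by fun_prop) (by fun_prop) h4
  have hc : Continuous fun p : ℝ × ℝ => regB2 p.1 p.2 := by unfold regB2; fun_prop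
  have hG : ContinuousAt (fun y => regB2 y (Einf y)) yTwo :=
    (hc.continuousAt (x := (yTwo, Einf yTwo))).comp (f := fun y => (y, Einf y)) (continuousAt_id.prodMk hE)
  rw [← regB2_yTwo_eq]
  refine ((hG.tendsto).mono_left nhdsWithin_le_nhds).congr' ?_
  filter_upwards [self_mem_nhdsWithin] with y hy
  exact (sub_mul_limB2_eq hy).symm

/-- `y_2 = stripYT 2` (the tree's two descriptions of the width-two threshold agree). [cite: BeatonBousquetMelouDeGierDuminilCopinGuttmann2014, Corollary 8 (arXiv v5 p. 12); lane plumbing] -/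
theorem stripYT_two_eq_yTwo : stripYT 2 = yTwo := by rw [stripYT_two, yTwo_eq]

/-- ★★★★ **THE RESIDUE OF `B_2(x_c; ·)` AT ITS RADIUS, IN CLOSED FORM**: `(y_2 − y) · B_2(x_c; y) ⟶ (233 + 185√2)/98 = 5.0472…`
as `y ↑ y_2 = (10 + 8√2)/7` — from the tree's solved width-two strip `W2.limB2`. [cite: BeatonBousquetMelouDeGierDuminilCopinGuttmann2014, Corollary 8 (arXiv v5 p. 12: the radius y_T); BeatonGuttmannJensen2012, §2 (the width-two series at y = 1); lane «pcv-sawmu» a-p2 g21 — own result] -/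
theorem tendsto_sub_mul_stripByLim_two :
    Tendsto (fun y => (stripYT 2 - y) * stripByLim 2 y) (𝓝[<] stripYT 2) (𝓝 ((233 + 185 * Real.sqrt 2) / 98)) := by
  rw [stripYT_two_eq_yTwo]
  refine tendsto_sub_mul_limB2.congr' ?_
  have h0 : (0 : ℝ) < yTwo := by linarith [one_lt_yTwo]
  filter_upwards [Ioo_mem_nhdsLT h0] with y hy
  rw [stripByLim_two_eq hy.1.le hy.2]

/-- ★★★★ **THE β-COEFFICIENT AMPLITUDE OF THE WIDTH-TWO STRIP, IN CLOSED FORM**: `β_{2,m} · y_2^m ⟶ Λ_2 = (45 + √2)/28 = 1.6576504…`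
(`y_2 = (10 + 8√2)/7`): the `x_c`-weighted number of walks of the two-cell honeycomb strip from the mid-edge `a` to the upper boundary with
exactly `m` surface contacts is `((45 + √2)/28 + o(1)) · y_2^{−m}`.  (The general law «BETA-COEFF-ALL-T» gives `∃ Λ_2 > 0` with the residue
`Λ_2 y_2`; §1–§2 compute the residue, so `Λ_2 = (233 + 185√2)/(98 y_2) = (45 + √2)/28`.)  A number the enumeration side can test
(`β_{2,m}` is computable by transfer matrix). [cite: BeatonBousquetMelouDeGierDuminilCopinGuttmann2014, §3.2 and Corollary 8 (arXiv v5 p. 12); BeatonGuttmannJensen2012, §2; lane «pcv-sawmu» a-p2 g21 — own result] -/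
theorem tendsto_stripBcoeff_two_mul_pow :
    Tendsto (fun m : ℕ => stripBcoeff 2 m * stripYT 2 ^ m) atTop (𝓝 ((45 + Real.sqrt 2) / 28)) := by
  obtain ⟨Λ, hΛ, hlim, hres⟩ := exists_tendsto_sub_mul_stripByLim_of_one_le (T := 2) (by norm_num)
  have huniq : Λ * stripYT 2 = (233 + 185 * Real.sqrt 2) / 98 := tendsto_nhds_unique hres tendsto_sub_mul_stripByLim_two
  have hr : Real.sqrt 2 ^ 2 = 2 := Real.sq_sqrt (by norm_num)
  have hy : stripYT 2 = (10 + 8 * Real.sqrt 2) / 7 := stripYT_two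
  have hy0 : (10 + 8 * Real.sqrt 2) / 7 ≠ 0 := by positivity
  have hΛeq : Λ = (45 + Real.sqrt 2) / 28 := by
    rw [hy] at huniq
    have : Λ = (233 + 185 * Real.sqrt 2) / 98 / ((10 + 8 * Real.sqrt 2) / 7) := by rw [← huniq, mul_div_cancel_right₀ _ hy0]
    rw [this, div_eq_iff hy0]
    linear_combination (-2 / 49 : ℝ) * hr
  rwa [hΛeq] at hlim

end Literature.Probability.RandomPlanarGeometry.SAW.HV
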